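import Literature.AlgebraicGeometry.HodgeTheory.WeilFamilyBalanced
import HarnessLib

/-!
# Deligne's abelian scheme with `K`-action: the charts suffice (named fact) ⇒ balanced fibres ⇒ the global-action package

Companion of `WeilFamilyGlobalAction` (named fact `deligne1982_weilFamily_globalAction`, M') and
`WeilFamilyBalanced`. In the proof of [Deligne1982HodgeCycles, Thm. 4.8] (LNM 900, p. 48) the
family through an abelian variety `(A, ν)` of Weil type is an abelian scheme `Y/S` with an action
`ν` of `E = ℚ(√-p)` such that "(a) for all `s ∈ S`, `(Y_s, ν_s)` satisfies the equivalent
statements in (4.4)" (balanced Weil type), "(b) `Y_{s₀} = A₀ ⊗ E`", "(c) `(Y_{s₁}, ν_{s₁}) = (A, ν)`",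
and the Weil classes are flat along it (p. 50). The named fact M' records (a) at EVERY fibre as part
of the debt. This file removes it:

* `deligne1982_weilFamily_kAction` (NAMED FACT, M'') — verbatim M' except that the per-fibre clause
  only asks for the CHART: an abelian `2k`-fold `(A'_s, φ'_s)`, `φ'_s ≫ φ'_s = -p`, and
  `e'_s : A'_s ≅ 𝒳_s` intertwining `φ'_s` and the global endomorphism `g` — i.e. exactly what an
  abelian scheme with `𝒪_K`-action supplies fibrewise — and no longer that the Weil classes of
  `(A'_s, φ'_s)` are of Hodge type `(k, k)`.
* `deligne1982_weilFamily_globalAction_of_kAction` (THEOREM): M'' → M'. Balanced Weil type holds at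
  `s₁` because the non-zero `(k,k)`-class `c` lies in the Weil plane of `(X, Φ) ≅ (𝒳_{s₁}, g_{s₁})`
  (Deligne's Prop. 4.4 ⇒, `finrank_eq_of_mem_weilClassesOf`), and PROPAGATES to every fibre along a
  path of the connected base (`finrank_eigenspace_inf_hodgeOneZero_eq_of_path`,
  `WeilFamilyBalanced`: Hodge–Riemann signs in degree one transported in the local system
  `R¹ f_* ℂ`, which commutes with `g`); the charts `e'_s` move the eigen-Hodge numbers between the
  fibre and `(A'_s, φ'_s)` (`finrank_eigenspace_inf_hodgeOneZero_eq_of_iso`), and balancedness gives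
  the type `(k,k)` of every Weil class (Prop. 4.4 ⇐, `isOfHodgeType_of_mem_weilClassesOf`).
* Hence `deligne1982_weilFamily_hodgeWeilSection_of_kAction`,
  `deligne1982_weilFamily_flatWeilSection_of_kAction` (M'' ⇒ F4', F4).

So the residual debt of the Weil-family packages is the CONSTRUCTION alone: the abelian scheme with
`𝒪_K`-action through `X` over a smooth irreducible quasi-projective base (fibrewise charts), its
CM/tensor-isogenous fibre, and one continuous section of `R^{2k} f_* ℂ` through `c`.

## References

* [Deligne1982HodgeCycles] P. Deligne (notes by J. S. Milne), Hodge cycles on abelian varieties,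
  LNM 900 (1982), Prop. 4.4, Thm. 4.8 and its proof pp. 48–51.
* [vanGeemen1994HodgeAV] B. van Geemen, An introduction to the Hodge conjecture for abelian
  varieties, LNM 1594 (1994), 5.2–5.11.
* [Andre1996Motifs] Y. André, Pour une théorie inconditionnelle des motifs, Publ. Math. IHÉS 83
  (1996), Lemme 6.3.3.
-/

noncomputable section

open CategoryTheory AlgebraicGeometry Limits MonoidalCategory CartesianMonoidalCategory
open Literature.AlgebraicTopology.SingularHomology

namespace Literature.AlgebraicGeometry.HodgeTheory

/-- **Deligne's abelian scheme with `K`-action through `X`, charts only** (NAMED FACT). Let `p` be a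
prime, `k ≥ 1`, `(X, Φ)` a complex abelian `2k`-fold with `Φ ≫ Φ = -p`, and `c` a non-zero rational
class of Hodge type `(k,k)` in the strong Weil plane `weilClassesOf X Φ k p`. Then there are a smooth
projective family `f : 𝒳 → S` of relative dimension `2k`, embedded in `ℙᴺ × S`, over a smooth
irreducible quasi-projective `ℂ`-scheme `S`, an endomorphism `g` of `𝒳` OVER `S` (the action of
`√-p`, proof of Thm. 4.8 p. 48), a point `s₁` and `e : X ≅ 𝒳_{s₁}` intertwining `Φ` and `g`
(clause (c)), at EVERY point `s` an abelian `2k`-fold `(A', φ')`, `φ' ≫ φ' = -p`, with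
`e' : A' ≅ 𝒳_s` intertwining `φ'` and `g` (the fibres of the abelian scheme with its
`𝒪_K`-action — NO Hodge-theoretic condition), a CONTINUOUS SECTION `σ` of `FiberClass f (2k)`
through `e^{-1 *} c` at `s₁` (flatness of the Weil classes, "`Γ ⊂ SU`", p. 50;
[vanGeemen1994HodgeAV, 5.8–5.11]), and a point `s₀` whose fibre is `e₀ : Y ≅ 𝒳_{s₀}` for an
abelian variety `(Y, Ψ)`, `e₀` intertwining `Ψ` and `g`, admitting an isogeny pair towards a tensor
point `(A₁ × A₁, (x, y) ↦ (-p·y, x))` (clause (b); in general the diagonal CM point of the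
component, [vanGeemen1994HodgeAV, 5.4–5.7], [Andre1996Motifs, Lemme 6.3.3]). This is
`deligne1982_weilFamily_globalAction` with clause (a) ("every fibre is of balanced Weil type")
REMOVED — it is a theorem (`deligne1982_weilFamily_globalAction_of_kAction`). The tree constructs no
moduli space of abelian varieties, no universal abelian scheme and no period map (2026-08-16),
which is why this is a NAMED FACT. [cite: Deligne1982HodgeCycles, proof of Thm. 4.8 (pp. 47–52), clauses (b), (c)]
[cite: vanGeemen1994HodgeAV, §5.3–5.11] [cite: Andre1996Motifs, Lemme 6.3.3] -/
def deligne1982_weilFamily_kAction : Prop :=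
  ∀ p : ℕ, p.Prime → p % 4 = 3 → 7 ≤ p → ∀ (k : ℕ), 1 ≤ k →
    ∀ (X : Motives.AbelianVariety ℂ) (Φ : X ⟶ X), X.dim = 2 * k → Φ ≫ Φ = -((p : ℤ) • 𝟙 X) →
    ∀ c : complexBetti X.X (2 * k), c ∈ weilClassesOf X Φ k p → c ≠ 0 → IsRationalClass c →
      IsOfHodgeType (2 * k) X.X (2 * k) k k c →
      ∃ (𝒳 S : Motives.SchemeOver ℂ) (f : 𝒳 ⟶ S) (g : 𝒳 ⟶ 𝒳) (s₁ s₀ : Motives.ComplexPoints S)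
        (e : X.X ≅ Motives.fiberOver f s₁) (σ : Motives.ComplexPoints S → FiberClass f (2 * k)),
        Motives.IsSmoothProjectiveFamily f (2 * k) ∧
        (∃ (N : ℕ) (ι : 𝒳 ⟶ Motives.projectiveSpace N ℂ ⊗ S),
            IsClosedImmersion ι.left ∧ ι ≫ snd (Motives.projectiveSpace N ℂ) S = f) ∧
        IrreducibleSpace S.left ∧ AlgebraicGeometry.Smooth S.hom ∧ IsQuasiProjectiveOver S ∧
        g ≫ f = f ∧
        (∀ s : Motives.ComplexPoints S, ∃ (A' : Motives.AbelianVariety ℂ) (φ' : A' ⟶ A')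
            (e' : A'.X ≅ Motives.fiberOver f s),
          A'.dim = 2 * k ∧ φ' ≫ φ' = -((p : ℤ) • 𝟙 A') ∧
          (e'.hom ≫ Motives.fiberι f s) ≫ g = φ'.hom.hom.hom ≫ (e'.hom ≫ Motives.fiberι f s)) ∧
        (e.hom ≫ Motives.fiberι f s₁) ≫ g = Φ.hom.hom.hom ≫ (e.hom ≫ Motives.fiberι f s₁) ∧
        Continuous σ ∧ (∀ s, (σ s).pt = s) ∧
        σ s₁ = ⟨s₁, complexBetti.map e.inv (2 * k) c⟩ ∧
        ∃ (Y : Motives.AbelianVariety ℂ) (Ψ : Y ⟶ Y) (e₀ : Y.X ≅ Motives.fiberOver f s₀),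
          (∃ (A₁ : Motives.AbelianVariety ℂ) (f₁ : Y ⟶ A₁.prod A₁) (g₁ : A₁.prod A₁ ⟶ Y) (m : ℕ),
            A₁.dim = k ∧ Y.dim = 2 * k ∧ Ψ ≫ Ψ = -((p : ℤ) • 𝟙 Y) ∧ 0 < m ∧
            f₁ ≫ g₁ = m • 𝟙 Y ∧ Flat f₁.hom.hom.hom.left ∧
            g₁ ≫ Ψ = Motives.AbelianVariety.prodLift
              (Motives.AbelianVariety.snd A₁ A₁ ≫ (-((p : ℤ) • 𝟙 A₁)))
              (Motives.AbelianVariety.fst A₁ A₁) ≫ g₁) ∧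
          (e₀.hom ≫ Motives.fiberι f s₀) ≫ g = Ψ.hom.hom.hom ≫ (e₀.hom ≫ Motives.fiberι f s₀)

section Proofs

variable {𝒳 S : Motives.SchemeOver ℂ} (π : 𝒳 ⟶ S)

/-- `finrank_eigenspace_inf_hodgeOneZero_eq_of_path` with the fibre dimension spelled `n ≥ 1`
instead of `d + 1`. [cite: Deligne1982HodgeCycles, proof of Thm. 4.8 (a) with Prop. 4.4] -/
theorem finrank_eigenspace_inf_hodgeOneZero_eq_of_path' {n k m : ℕ} (hn : 1 ≤ n)
    (hsp : ∀ t : Motives.ComplexPoints S, Motives.IsSmoothProjective n (Motives.fiberOver π t))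
    (hU : IsCohomologicallyLocallyTrivialOn π (Set.univ : Set (Motives.ComplexPoints S)))
    (g : 𝒳 ⟶ 𝒳) (hg : g ≫ π = π)
    (gf : ∀ t : Motives.ComplexPoints S, Motives.fiberOver π t ⟶ Motives.fiberOver π t)
    (hgf : ∀ t, gf t ≫ Motives.fiberι π t = Motives.fiberι π t ≫ g) (μ : ℂ)
    (ε : 𝒳 ⟶ Motives.projectiveSpace m ℂ)
    (hε : ∀ t : Motives.ComplexPoints S, IsClosedImmersion (Motives.fiberι π t ≫ ε).left)
    {s₁ t : Motives.ComplexPoints S}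
    (γ : Path.Homotopic.Quotient (⟨s₁, Set.mem_univ s₁⟩ : (Set.univ : Set (Motives.ComplexPoints S)))
      ⟨t, Set.mem_univ t⟩)
    (hE : Module.finrank ℂ ↥(Module.End.eigenspace (complexBetti.map (gf s₁) 1).hom μ) = 2 * k)
    (hbal : Module.finrank ℂ ↥(Module.End.eigenspace (complexBetti.map (gf s₁) 1).hom μ ⊓
      hodgeOneZero (hsp s₁)) = k) :
    Module.finrank ℂ ↥(Module.End.eigenspace (complexBetti.map (gf t) 1).hom μ ⊓
      hodgeOneZero (hsp t)) = k := by
  obtain ⟨d, rfl⟩ := Nat.exists_eq_add_one_of_ne_zero (by omega : n ≠ 0)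
  exact finrank_eigenspace_inf_hodgeOneZero_eq_of_path π hsp hU g hg gf hgf μ ε hε γ hE hbal

/-- **The charts suffice**: `deligne1982_weilFamily_kAction → deligne1982_weilFamily_globalAction`
(clause (a), balanced Weil type of every fibre, is recovered from the charts: it holds at `s₁` by
Deligne's Prop. 4.4 applied to `c`, propagates along paths of the connected base by the transported
Hodge–Riemann form, `finrank_eigenspace_inf_hodgeOneZero_eq_of_path`, and gives the Hodge type
`(k,k)` of all Weil classes of `(A'_s, φ'_s)` by Prop. 4.4 again).
[cite: Deligne1982HodgeCycles, proof of Thm. 4.8 (pp. 48–51) with Prop. 4.4]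
[cite: vanGeemen1994HodgeAV, Lemma 5.2 (4)] -/
theorem deligne1982_weilFamily_globalAction_of_kAction (h : deligne1982_weilFamily_kAction) :
    deligne1982_weilFamily_globalAction := by
  intro p hp hp4 hp7 k hk X Φ hX hΦ c hc hc0 hrat hH
  obtain ⟨𝒳, S, f, g, s₁, s₀, e, σ, hfam, hemb, hirr, hsm, hSqp, hg, hfib, he, hσ, hpt, hσ₁, Y, Ψ,
    e₀, hiso, he₀⟩ := h p hp hp4 hp7 k hk X Φ hX hΦ c hc hc0 hrat hH
  refine ⟨𝒳, S, f, g, s₁, s₀, e, σ, hfam, hemb, hirr, hsm, hSqp, hg, fun s ↦ ?_, he, hσ, hpt, hσ₁, Y,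
    Ψ, e₀, hiso, he₀⟩
  have hp0 : 0 < p := hp.pos
  -- the base: `S(ℂ)` is a path-connected manifold and `R• f_* ℂ` is a local system on it
  haveI := hsm
  haveI := hirr
  haveI : LocallyOfFiniteType S.hom := hSqp.locallyOfFiniteType
  haveI : ConnectedSpace (Motives.ComplexPoints S) :=
    (Motives.ComplexPoints.connectedSpace_iff_holds S).2 inferInstance
  obtain ⟨dS, hdS⟩ := exists_smoothOfRelativeDimension_of_connectedSpace_complexPoints S
  haveI := hdS
  haveI := pathConnectedSpace_complexPoints_of_smoothOfRelativeDimension S dS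
  have hU := isCohomologicallyLocallyTrivialOn_univ_of_isSmoothProjectiveFamily f dS hfam hSqp
  -- the fibre maps of `g`, the fibres, their common projective space
  have hgf' := fun t ↦ exists_fiberHom_comp_fiberι f g hg t
  choose gf hgf using hgf'
  have hsp : ∀ t : Motives.ComplexPoints S, Motives.IsSmoothProjective (2 * k) (Motives.fiberOver f t) :=
    fun t ↦ hfam.isSmoothProjective t
  obtain ⟨m, ε, hε⟩ := exists_forall_isClosedImmersion_fiberι_comp f hfam hemb hSqp
  -- balancedness at `s₁`, read through the chart `e`
  have hΦ' : Φ ≫ Φ = -(p • 𝟙 X) := by rw [hΦ, natCast_zsmul]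
  have he' : e.hom ≫ gf s₁ = Φ.hom.hom.hom ≫ e.hom :=
    hom_comp_fiberHom_eq_of_comp_fiberι f g (hgf s₁) e Φ.hom.hom.hom he
  set μ : ℂ := Complex.I * (Real.sqrt p : ℂ) with hμ
  have hE₁ : Module.finrank ℂ ↥(Module.End.eigenspace (complexBetti.map (gf s₁) 1).hom μ) = 2 * k := by
    rw [finrank_eigenspace_eq_of_iso e (gf s₁) he' μ 1]
    have h2 := two_mul_finrank_eigenspace_eq hp0 hΦ'
    rw [Motives.AbelianVariety.finrank_complexBetti_one, hX, ← hμ] at h2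
    omega
  have hbal₁ : Module.finrank ℂ ↥(Module.End.eigenspace (complexBetti.map (gf s₁) 1).hom μ ⊓
      hodgeOneZero (hsp s₁)) = k := by
    rw [finrank_eigenspace_inf_hodgeOneZero_eq_of_iso hX (hsp s₁) e (gf s₁) he' μ]
    exact finrank_eq_of_mem_weilClassesOf hk hX hp0 hΦ' hc hc0 hH
  -- the chart at `s` and the propagated balancedness
  obtain ⟨A', φ', e', hA', hφ', he'c⟩ := hfib s
  refine ⟨A', φ', e', hA', hφ', he'c, fun w hw ↦ ?_⟩
  have hφ'' : φ' ≫ φ' = -(p • 𝟙 A') := by rw [hφ', natCast_zsmul]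
  have he'' : e'.hom ≫ gf s = φ'.hom.hom.hom ≫ e'.hom :=
    hom_comp_fiberHom_eq_of_comp_fiberι f g (hgf s) e' φ'.hom.hom.hom he'c
  let γ : Path (⟨s₁, Set.mem_univ s₁⟩ : (Set.univ : Set (Motives.ComplexPoints S))) ⟨s, Set.mem_univ s⟩ :=
    (PathConnectedSpace.somePath s₁ s).map (continuous_id.subtype_mk _)
  have hbal : Module.finrank ℂ ↥(Module.End.eigenspace (complexBetti.map φ'.hom.hom.hom 1).hom μ ⊓
      hodgeOneZero (Motives.isSmoothProjective_of_dim_eq' hA')) = k := by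
    rw [← finrank_eigenspace_inf_hodgeOneZero_eq_of_iso hA' (hsp s) e' (gf s) he'' μ]
    exact finrank_eigenspace_inf_hodgeOneZero_eq_of_path' f (by omega) hsp hU g hg gf hgf μ ε hε ⟦γ⟧
      hE₁ hbal₁
  exact isOfHodgeType_of_mem_weilClassesOf hk hA' hp0 hφ'' hbal hw

/-- **Hence the fibrewise-Hodge flat Weil section** from the charts-only fact:
`deligne1982_weilFamily_kAction → deligne1982_weilFamily_hodgeWeilSection`.
[cite: Deligne1982HodgeCycles, proof of Thm. 4.8 (pp. 48–51) with Prop. 4.4] -/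
theorem deligne1982_weilFamily_hodgeWeilSection_of_kAction (h : deligne1982_weilFamily_kAction) :
    deligne1982_weilFamily_hodgeWeilSection :=
  deligne1982_weilFamily_hodgeWeilSection_of_globalAction
    (deligne1982_weilFamily_globalAction_of_kAction h)

/-- **And the flat Weil section package**:
`deligne1982_weilFamily_kAction → deligne1982_weilFamily_flatWeilSection`.
[cite: Deligne1982HodgeCycles, proof of Thm. 4.8 (pp. 48–51)] -/
theorem deligne1982_weilFamily_flatWeilSection_of_kAction (h : deligne1982_weilFamily_kAction) :
    deligne1982_weilFamily_flatWeilSection :=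
  deligne1982_weilFamily_flatWeilSection_of_globalAction
    (deligne1982_weilFamily_globalAction_of_kAction h)

/-- **The converse projection**: `deligne1982_weilFamily_globalAction → deligne1982_weilFamily_kAction`
(forget clause (a), the Hodge type `(k,k)` of the Weil classes of the charts). Together with
`deligne1982_weilFamily_globalAction_of_kAction` this records that the two named facts M' and M''
are EQUIVALENT packagings of the one printed construction (proof of Thm. 4.8), both implied by
`deligne1982_weilFamily_levelStructure` (`WeilFamilyLevelStructure`). [cite: Deligne1982HodgeCycles, proof of Thm. 4.8 (pp. 48–51)] -/
theorem deligne1982_weilFamily_kAction_of_globalAction (h : deligne1982_weilFamily_globalAction) :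
    deligne1982_weilFamily_kAction := by
  intro p hp hp4 hp7 k hk X Φ hX hΦ c hc hc0 hrat hH
  obtain ⟨𝒳, S, f, g, s₁, s₀, e, σ, hfam, hemb, hirr, hsm, hSqp, hg, hfib, he, hσ, hpt, hσ₁, Y, Ψ,
    e₀, hiso, he₀⟩ := h p hp hp4 hp7 k hk X Φ hX hΦ c hc hc0 hrat hH
  refine ⟨𝒳, S, f, g, s₁, s₀, e, σ, hfam, hemb, hirr, hsm, hSqp, hg, fun s ↦ ?_, he, hσ, hpt, hσ₁, Y,
    Ψ, e₀, hiso, he₀⟩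
  obtain ⟨A', φ', e', hA', hφ', he'c, -⟩ := hfib s
  exact ⟨A', φ', e', hA', hφ', he'c⟩

/-- **M' ⇔ M''**: `deligne1982_weilFamily_globalAction ↔ deligne1982_weilFamily_kAction` — clause (a)
of the global-action package is exactly what the charts already give
(`deligne1982_weilFamily_globalAction_of_kAction`), so the two named facts carry one and the same
debt, that of the construction `deligne1982_weilFamily_levelStructure`.
[cite: Deligne1982HodgeCycles, proof of Thm. 4.8 (pp. 48–51) with Prop. 4.4] -/
theorem deligne1982_weilFamily_globalAction_iff_kAction :
    deligne1982_weilFamily_globalAction ↔ deligne1982_weilFamily_kAction :=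
  ⟨deligne1982_weilFamily_kAction_of_globalAction, deligne1982_weilFamily_globalAction_of_kAction⟩

end Proofs

end Literature.AlgebraicGeometry.HodgeTheory

end
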